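import Summits.ResolutionOfSingularities.ResolutionOfSingularities.Theorems.WildQuotientsSummitReductionStubPairOrbitNormalFormBlowupModelSing
import Literature.AlgebraicGeometry.Resolution.RsopMonomialIdeals
import Literature.AlgebraicGeometry.Resolution.RegularLocalRingsJacobian
import HarnessLib

/-!
# `WildQuotients.SummitReduction` (stmt-ResolutionOfSingularities-16324), line `FramePerfect`, stub S
# (`stub_pair_orbitNormalFormBlowup`): the singular locus of the coefficient-free model ring
# `A⟦u, v⟧/(uv - t₁ ⋯ t_s)` lies in `⋃_{a<b≤s} V(u, v, t_a, t_b)`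

Route `ResolutionOfSingularities/WildQuotients`, crux `SummitReduction`; helper file of the line
skeleton (v8), stub S = the orbit version of de Jong 1996, Claim 4.27 for
`DeJong1997.QuasiSplitNormalFormPair`. Sibling of `…OrbitNormalFormBlowupModelSing.lean`
(`V(u, v, t_a, t_b) ⊆ Sing`); this file proves the converse inclusion of de Jong 1996, 3.5 ("We
remark that this implies that `Sing(X)` has pure codimension three in `X`", p. 64; 4.27: "Since
`E` is smooth, its ideal in the rings of (ii) is given by `(u, v, t₁, t₂)` after renumbering",
p. 75) COEFFICIENT-FREE, i.e. for `R = A⟦u, v⟧/(uv - t₁ ⋯ t_s)` over an abstract regular local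
ring `A` with regular system of parameters `t` (de Jong 1997, p. 619), where no Jacobian
criterion is available for the `t`-variables:

* `not_isRegularLocalRing_localization_quotient_of_mul_mem_sq` — a hypersurface `C/(f)` in a
  regular domain is singular at a prime `𝔮` as soon as `w f ∈ Q²` for some `w ∉ Q` (`f ∈ Q²C_Q`);
* `isRegularRing_mvPowerSeries_quotient_span_C` — `A⟦X⟧/(a) ≅ (A/a)⟦X⟧` is a regular ring for
  `a ∈ 𝔪_A ∖ 𝔪_A²`;
* `mul_C_notMem_sq` — hence `C(a) ∉ Q⁽²⁾` for every prime `Q ∋ C(a)` of `A⟦X⟧`: `w ∉ Q` forces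
  `w · C(a) ∉ Q²` (this replaces `∂/∂t_a` of the field case);
* `exists_mem_of_not_isRegularLocalRing_nodeDeformationRing` — **`Sing(R) ⊆ ⋃_{a<b<s} V(u, v,
  t_a, t_b)`**: if `R_𝔮` is not regular then `u, v ∈ 𝔮` (the `A`-derivations `∂/∂u`, `∂/∂v`
  of `A⟦u, v⟧`, tree `Derivation.apply_mem_comap_of_not_isRegularLocalRing`) and at least TWO of
  `t₀, …, t_{s-1}` lie in `𝔮` (if only `t_a` did, `uv - t_a · e` with `e ∉ Q` would not lie in
  `Q²A⟦u,v⟧_Q`, by `mul_C_notMem_sq`).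

## Sources

* A. J. de Jong, *Smoothness, semi-stability and alterations*, Publ. Math. IHÉS 83 (1996), 3.5
  (p. 64), 4.27 (pp. 75–76). [DeJong1996]
* A. J. de Jong, *Families of curves and alterations*, Ann. Inst. Fourier 47 (1997), proof of
  Prop. 5.11, p. 619. [DeJong1997]
* H. Matsumura, *Commutative Ring Theory* (1986), Thm. 14.2, Thm. 19.3. [Matsumura1987]
* The Stacks Project, Tag 07PF. [StacksProject]
-/

set_option linter.dupNamespace false -- the tree's summit namespace repeats `ResolutionOfSingularities`

noncomputable section

open IsLocalRing
open Literature.AlgebraicGeometry.Resolution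

namespace Summit.ResolutionOfSingularities.ResolutionOfSingularities.Theorems

/-! ## Hypersurface singularities along `f ∈ Q²C_Q` -/

/-- **A hypersurface is singular along `f ∈ Q²C_Q`**: in a regular domain `C`, if `f ≠ 0` and
`w f ∈ Q²` for some `w ∉ Q` (`Q` the prime of `C` under the prime `𝔮` of `C/(f)`), then
`(C/(f))_𝔮 ≅ C_Q/(f)` is not a regular local ring (`w` is a unit of `C_Q`, so `f ∈ 𝔪²` there,
and a regular local ring modulo a non-zero element of `𝔪²` is not regular).
[cite: Matsumura1987, Thm. 14.2] -/
theorem not_isRegularLocalRing_localization_quotient_of_mul_mem_sq {C : Type} [CommRing C]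
    [IsRegularRing C] [IsDomain C] {f : C} (hf0 : f ≠ 0) (P : Ideal (C ⧸ Ideal.span {f}))
    [P.IsPrime] {w : C} (hw : w ∉ P.comap (Ideal.Quotient.mk (Ideal.span {f})))
    (hwf : w * f ∈ P.comap (Ideal.Quotient.mk (Ideal.span {f})) ^ 2) :
    ¬ IsRegularLocalRing (Localization.AtPrime P) := by
  -- adapted from `not_isRegularLocalRing_localization_quotient_of_mem_sq` (PowerSeriesRegularLocal.lean)
  intro hreg
  set Q : Ideal C := P.comap (Ideal.Quotient.mk (Ideal.span {f})) with hQdef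
  haveI hQ : Q.IsPrime := Ideal.comap_isPrime _ P
  set S := Localization.AtPrime Q with hSdef
  haveI : IsRegularLocalRing S := IsRegularRing.isRegularLocalRing_localization Q
  haveI : IsDomain S := isDomain_of_isRegularLocalRing S
  set f' : S := algebraMap C S f with hf'
  have hwu : IsUnit (algebraMap C S w) := IsLocalization.map_units S (⟨w, hw⟩ : Q.primeCompl)
  have hfm2 : f' ∈ maximalIdeal S ^ 2 := by
    have h1 : algebraMap C S w * f' ∈ maximalIdeal S ^ 2 := by
      rw [hf', ← map_mul, ← Localization.AtPrime.map_eq_maximalIdeal, ← Ideal.map_pow]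
      exact Ideal.mem_map_of_mem _ hwf
    have := Ideal.mul_mem_left _ (hwu.unit⁻¹ : Sˣ).val h1
    rwa [← mul_assoc, IsUnit.val_inv_mul, one_mul] at this
  have hf'0 : f' ≠ 0 := by
    intro h0
    apply hf0
    have hinj : Function.Injective (algebraMap C S) :=
      IsLocalization.injective S (Ideal.primeCompl_le_nonZeroDivisors Q)
    rw [hf', ← map_zero (algebraMap C S)] at h0
    exact hinj h0
  haveI hreg' : IsRegularLocalRing (S ⧸ Ideal.span {f'}) :=
    IsRegularLocalRing.of_ringEquiv (localizationQuotientEquiv f P)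
  exact not_isRegularLocalRing_quotient_span_singleton_of_mem_sq hf'0 hfm2 hreg'

/-! ## `A⟦X⟧/(a) ≅ (A/a)⟦X⟧` -/

/-- **Reduction of coefficients modulo `a`**: the coefficientwise map
`A⟦X₁, …, X_n⟧ → (A/a)⟦X₁, …, X_n⟧` is surjective with kernel `(C a)`. [folklore] -/
theorem ker_map_mk_span_singleton_eq {A : Type} [CommRing A] (n : ℕ) (a : A) :
    RingHom.ker (MvPowerSeries.map (σ := Fin n) (Ideal.Quotient.mk (Ideal.span {a}))) =
      Ideal.span {MvPowerSeries.C a} ∧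
    Function.Surjective (MvPowerSeries.map (σ := Fin n) (Ideal.Quotient.mk (Ideal.span {a}))) := by
  constructor
  · apply le_antisymm
    · intro f hf
      rw [RingHom.mem_ker] at hf
      -- every coefficient of `f` is a multiple of `a`
      have hc : ∀ e : Fin n →₀ ℕ, ∃ b : A, b * a = MvPowerSeries.coeff e f := fun e => by
        have := congrArg (MvPowerSeries.coeff e) hf
        rw [MvPowerSeries.coeff_map, map_zero, Ideal.Quotient.eq_zero_iff_mem] at this
        exact Ideal.mem_span_singleton'.mp this
      choose g hg using hc
      let G : MvPowerSeries (Fin n) A := fun e => g e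
      have : f = MvPowerSeries.C a * G := by
        ext e
        rw [MvPowerSeries.coeff_C_mul, mul_comm]
        exact (hg e).symm
      rw [this]
      exact Ideal.mul_mem_right _ _ (Ideal.mem_span_singleton_self _)
    · rw [Ideal.span_le, Set.singleton_subset_iff, SetLike.mem_coe, RingHom.mem_ker]
      ext e
      rw [MvPowerSeries.coeff_map, MvPowerSeries.coeff_C, map_zero]
      split_ifs
      · exact Ideal.Quotient.eq_zero_iff_mem.mpr (Ideal.mem_span_singleton_self a)
      · exact map_zero _
  · intro g
    choose c hc using fun e : Fin n →₀ ℕ => Ideal.Quotient.mk_surjective (MvPowerSeries.coeff e g)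
    refine ⟨fun e => c e, ?_⟩
    ext e
    rw [MvPowerSeries.coeff_map]
    exact hc e

/-- **`A⟦X₁, …, X_n⟧/(a)` is a regular ring for `a ∈ 𝔪_A ∖ 𝔪_A²`** (`A` regular local): it is
`(A/a)⟦X⟧` with `A/a` regular local (Matsumura 14.2), a regular ring by Serre.
[cite: Matsumura1987, Thm. 14.2 and Thm. 19.3] -/
theorem isRegularRing_mvPowerSeries_quotient_span_C {A : Type} [CommRing A] [IsRegularLocalRing A]
    (n : ℕ) {a : A} (ha : a ∈ maximalIdeal A) (ha2 : a ∉ maximalIdeal A ^ 2) :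
    IsRegularRing (MvPowerSeries (Fin n) A ⧸ Ideal.span {MvPowerSeries.C (σ := Fin n) a}) := by
  haveI : IsRegularLocalRing (A ⧸ Ideal.span {a}) :=
    (IsRegularLocalRing.quotient_span_singleton ha ha2).1
  haveI := isRegularRing_mvPowerSeries_of_isRegularLocalRing (A ⧸ Ideal.span {a}) n
  obtain ⟨hker, hsurj⟩ := ker_map_mk_span_singleton_eq n a
  let e := (Ideal.quotEquivOfEq hker.symm).trans
    (RingHom.quotientKerEquivOfSurjective hsurj)
  exact IsRegularRing.of_ringEquiv e.symm

/-- **`C(a) ∉ Q⁽²⁾`**: for `A` regular local, `a ∈ 𝔪_A ∖ 𝔪_A²` and a prime `Q ∋ C(a)` of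
`A⟦X₁, …, X_n⟧`, no `w ∉ Q` has `w · C(a) ∈ Q²` (else the hypersurface `A⟦X⟧/(C a)`, a regular
ring, would be singular at `Q/(C a)`). [cite: Matsumura1987, Thm. 14.2 and Thm. 19.3] -/
theorem mul_C_notMem_sq {A : Type} [CommRing A] [IsRegularLocalRing A] (n : ℕ) {a : A}
    (ha : a ∈ maximalIdeal A) (ha2 : a ∉ maximalIdeal A ^ 2)
    (Q : Ideal (MvPowerSeries (Fin n) A)) [Q.IsPrime] (haQ : MvPowerSeries.C a ∈ Q)
    {w : MvPowerSeries (Fin n) A} (hw : w ∉ Q) : w * MvPowerSeries.C a ∉ Q ^ 2 := by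
  intro hwa
  haveI := isRegularRing_mvPowerSeries_of_isRegularLocalRing A n
  haveI : IsDomain A := isDomain_of_isRegularLocalRing A
  haveI : IsDomain (MvPowerSeries (Fin n) A) := NoZeroDivisors.to_isDomain _
  have ha0 : (MvPowerSeries.C (σ := Fin n) a) ≠ 0 := by
    intro h0
    apply ha2
    rw [(MvPowerSeries.C_injective (σ := Fin n) (R := A)).eq_iff' (map_zero _)] at h0
    rw [h0]
    exact zero_mem _
  -- the prime `Q/(C a)` of the hypersurface
  set I : Ideal (MvPowerSeries (Fin n) A) := Ideal.span {MvPowerSeries.C a} with hI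
  have hIQ : I ≤ Q := by
    rw [hI, Ideal.span_le, Set.singleton_subset_iff]
    exact haQ
  set P : Ideal (MvPowerSeries (Fin n) A ⧸ I) := Q.map (Ideal.Quotient.mk I) with hP
  haveI hPp : P.IsPrime := Ideal.map_isPrime_of_surjective Ideal.Quotient.mk_surjective
    (by rwa [Ideal.mk_ker])
  have hPQ : P.comap (Ideal.Quotient.mk I) = Q := by
    rw [hP, Ideal.comap_map_of_surjective _ Ideal.Quotient.mk_surjective,
      ← RingHom.ker_eq_comap_bot, Ideal.mk_ker]
    -- `Q ⊔ I = Q`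
    exact le_antisymm (sup_le le_rfl hIQ) le_sup_left
  haveI := isRegularRing_mvPowerSeries_quotient_span_C n ha ha2
  refine not_isRegularLocalRing_localization_quotient_of_mul_mem_sq ha0 P
    (w := w) (by rw [hPQ]; exact hw) (by rw [hPQ]; exact hwa) ?_
  exact IsRegularRing.isRegularLocalRing_localization P

/-! ## `Sing(A⟦u, v⟧/(uv - t₁ ⋯ t_s)) ⊆ ⋃_{a<b<s} V(u, v, t_a, t_b)` -/

/-- A regular system of parameters `t : Fin m → A` (`(t) = 𝔪_A`, `dim A = m`) is part of one in
the sense of `IsRsopPart` (so each `tᵢ ∈ 𝔪 ∖ 𝔪²`). [cite: Matsumura1987, Thm. 14.2] -/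
theorem isRsopPart_of_span_eq_of_ringKrullDim_eq {A : Type} [CommRing A] [IsRegularLocalRing A]
    {m : ℕ} (t : Fin m → A) (ht : Ideal.span (Set.range t) = maximalIdeal A)
    (hdim : ringKrullDim A = m) : IsRsopPart t := by
  have hd : (maximalIdeal A).spanFinrank = m := by
    have h := IsRegularLocalRing.spanFinrank_maximalIdeal (R := A)
    rw [hdim] at h
    exact_mod_cast h
  exact isRsopPart_comp_of_rsop hd t ht id Function.injective_id

/-- `Sing(A⟦u, v⟧/(uv - h)) ⊆ ⋃_{a<b<s} V(u, v, t_a, t_b)` for `h = ∏_{i<s} tᵢ` (the statement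
of `exists_mem_of_not_isRegularLocalRing_nodeDeformationRing` with the product generalised to a
variable `h`, for the proof). [cite: DeJong1996, 3.5 and 4.27, pp. 64, 75] -/
theorem exists_mem_of_not_isRegularLocalRing_nodeDeformationRing_aux {A : Type} [CommRing A]
    [IsRegularLocalRing A] {m : ℕ} (t : Fin m → A) (ht : Ideal.span (Set.range t) = maximalIdeal A)
    (hdim : ringKrullDim A = m) (s : ℕ) (h : A)
    (hh : h = ∏ i ∈ Finset.univ.filter (fun i : Fin m => i.val < s), t i)
    (𝔮 : Ideal (DeJong1996.NodeDeformationRing A h)) [𝔮.IsPrime]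
    (h𝔮 : ¬ IsRegularLocalRing (Localization.AtPrime 𝔮)) :
    Ideal.Quotient.mk _ (MvPowerSeries.X 0) ∈ 𝔮 ∧ Ideal.Quotient.mk _ (MvPowerSeries.X 1) ∈ 𝔮 ∧
      ∃ a b : Fin m, a < b ∧ b.val < s ∧
        DeJong1996.NodeDeformationRing.ofBase A _ (t a) ∈ 𝔮 ∧
          DeJong1996.NodeDeformationRing.ofBase A _ (t b) ∈ 𝔮 := by
  classical
  have hrsop := isRsopPart_of_span_eq_of_ringKrullDim_eq t ht hdim
  haveI := isRegularRing_mvPowerSeries_of_isRegularLocalRing A 2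
  set Q : Ideal (MvPowerSeries (Fin 2) A) :=
    𝔮.comap (Ideal.Quotient.mk (Ideal.span {DeJong1996.nodeDeformationRelation A h})) with hQ
  haveI hQp : Q.IsPrime := Ideal.comap_isPrime _ 𝔮
  have hFQ : DeJong1996.nodeDeformationRelation A h ∈ Q := mem_comap_mk_span_singleton _ 𝔮
  -- `u, v ∈ Q` by the derivations `∂/∂v, ∂/∂u`
  have hD : ∀ c : Fin 2, MvPowerSeries.pderiv c (DeJong1996.nodeDeformationRelation A h) ∈ Q :=
    fun c => Derivation.apply_mem_comap_of_not_isRegularLocalRing _ _ 𝔮 h𝔮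
  have hDF : ∀ c : Fin 2, MvPowerSeries.pderiv c (DeJong1996.nodeDeformationRelation A h) =
      MvPowerSeries.X 0 * MvPowerSeries.pderiv c (MvPowerSeries.X 1) +
        MvPowerSeries.X 1 * MvPowerSeries.pderiv c (MvPowerSeries.X 0) := fun c => by
    rw [DeJong1996.nodeDeformationRelation, map_sub, Derivation.leibniz, MvPowerSeries.c_eq_algebraMap,
      Derivation.map_algebraMap, sub_zero, smul_eq_mul, smul_eq_mul]
  have hu : (MvPowerSeries.X 0 : MvPowerSeries (Fin 2) A) ∈ Q := by
    have := hD 1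
    rw [hDF, MvPowerSeries.pderiv_X, MvPowerSeries.pderiv_X, if_pos rfl,
      if_neg (show (0 : Fin 2) ≠ 1 by decide), mul_one, mul_zero, add_zero] at this
    exact this
  have hv : (MvPowerSeries.X 1 : MvPowerSeries (Fin 2) A) ∈ Q := by
    have := hD 0
    rw [hDF, MvPowerSeries.pderiv_X, MvPowerSeries.pderiv_X, if_neg (show (1 : Fin 2) ≠ 0 by decide),
      if_pos rfl, mul_zero, mul_one, zero_add] at this
    exact this
  refine ⟨hu, hv, ?_⟩
  -- `h ∈ Q`, hence some `t_a ∈ Q`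
  have hCh : MvPowerSeries.C h ∈ Q := by
    have : MvPowerSeries.C h = MvPowerSeries.X 0 * MvPowerSeries.X 1 -
        DeJong1996.nodeDeformationRelation A h := by
      rw [DeJong1996.nodeDeformationRelation, sub_sub_cancel]
    rw [this]
    exact Ideal.sub_mem _ (Ideal.mul_mem_left _ _ hv) hFQ
  set q : Ideal A := Q.comap (MvPowerSeries.C (σ := Fin 2) (R := A)) with hq
  haveI hqp : q.IsPrime := Ideal.comap_isPrime _ Q
  have hhq : (∏ i ∈ Finset.univ.filter (fun i : Fin m => i.val < s), t i) ∈ q := by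
    rw [← hh]
    exact hCh
  obtain ⟨a, ha, haq⟩ := Ideal.IsPrime.prod_mem_iff.mp hhq
  have has : a.val < s := (Finset.mem_filter.mp ha).2
  -- a second index
  have hb : ∃ b ∈ Finset.univ.filter (fun i : Fin m => i.val < s), b ≠ a ∧ t b ∈ q := by
    by_contra hcon
    -- `e = ∏_{i<s, i≠a} tᵢ ∉ q` and `h = t_a e`
    set e : A := ∏ i ∈ (Finset.univ.filter (fun i : Fin m => i.val < s)).erase a, t i with he
    have heq : e ∉ q := by
      intro hmem
      obtain ⟨b, hb, hbq⟩ := Ideal.IsPrime.prod_mem_iff.mp hmem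
      exact hcon ⟨b, Finset.mem_of_mem_erase hb, Finset.ne_of_mem_erase hb, hbq⟩
    have hhe : h = t a * e := by
      rw [hh, he, Finset.mul_prod_erase _ _ ha]
    -- singularity: `w ∉ Q` with `w F ∈ Q²`
    obtain ⟨w, hw, hwF⟩ := exists_mul_mem_sq_of_not_isRegularLocalRing
      (DeJong1996.nodeDeformationRelation A h) 𝔮 h𝔮
    have hwCe : w * MvPowerSeries.C e ∉ Q := fun hmem =>
      (hQp.mem_or_mem hmem).elim hw heq
    apply mul_C_notMem_sq 2 (hrsop.mem_maximalIdeal a) (hrsop.not_mem_sq a) Q haq hwCe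
    -- `(w C e) C(t_a) = w X₀ X₁ - w F ∈ Q²`
    have h1 : w * MvPowerSeries.C e * MvPowerSeries.C (t a) =
        w * (MvPowerSeries.X 0 * MvPowerSeries.X 1) - w * DeJong1996.nodeDeformationRelation A h := by
      rw [DeJong1996.nodeDeformationRelation, hhe, map_mul]
      ring
    rw [h1]
    refine Ideal.sub_mem _ (Ideal.mul_mem_left _ _ ?_) hwF
    rw [pow_two]
    exact Ideal.mul_mem_mul hu hv
  obtain ⟨b, hb, hba, hbq⟩ := hb
  have hbs : b.val < s := (Finset.mem_filter.mp hb).2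
  -- order the pair
  have key : ∀ i : Fin m, t i ∈ q → DeJong1996.NodeDeformationRing.ofBase A _ (t i) ∈ 𝔮 :=
    fun i hi => hi
  rcases lt_or_gt_of_ne hba with hlt | hlt
  · exact ⟨b, a, hlt, has, key b hbq, key a haq⟩
  · exact ⟨a, b, hlt, hbs, key a haq, key b hbq⟩

/-- **The singular locus of the coefficient-free model ring** (de Jong 1996, 3.5/4.27; de Jong
1997, 5.11): let `A` be a regular local ring with regular system of parameters
`t₀, …, t_{m-1}` and `R = A⟦u, v⟧/(uv - ∏_{i<s} tᵢ)`. If `R_𝔮` is not regular then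
`u, v ∈ 𝔮` and `t_a, t_b ∈ 𝔮` for two indices `a < b < s`. The `A`-derivations `∂/∂u, ∂/∂v`
of the regular ring `A⟦u, v⟧` give `v, u ∈ Q` (the prime of `A⟦u, v⟧` under `𝔮`); then
`∏_{i<s} tᵢ ∈ Q`, so some `t_a ∈ Q`; and if no other `t_b` (`b < s`) lay in `Q`, then
`uv - ∏ tᵢ = uv - t_a e` with `e ∉ Q` could not lie in `Q²A⟦u,v⟧_Q` (`mul_C_notMem_sq`), whereas
singularity provides `w ∉ Q` with `w · (uv - t_a e) ∈ Q²`.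
[cite: DeJong1996, 3.5 and 4.27, pp. 64, 75] [cite: DeJong1997, proof of Prop. 5.11, p. 619] -/
theorem exists_mem_of_not_isRegularLocalRing_nodeDeformationRing {A : Type} [CommRing A]
    [IsRegularLocalRing A] {m : ℕ} (t : Fin m → A) (ht : Ideal.span (Set.range t) = maximalIdeal A)
    (hdim : ringKrullDim A = m) (s : ℕ)
    (𝔮 : Ideal (DeJong1996.NodeDeformationRing A
      (∏ i ∈ Finset.univ.filter (fun i : Fin m => i.val < s), t i))) [𝔮.IsPrime]
    (h𝔮 : ¬ IsRegularLocalRing (Localization.AtPrime 𝔮)) :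
    Ideal.Quotient.mk _ (MvPowerSeries.X 0) ∈ 𝔮 ∧ Ideal.Quotient.mk _ (MvPowerSeries.X 1) ∈ 𝔮 ∧
      ∃ a b : Fin m, a < b ∧ b.val < s ∧
        DeJong1996.NodeDeformationRing.ofBase A _ (t a) ∈ 𝔮 ∧
          DeJong1996.NodeDeformationRing.ofBase A _ (t b) ∈ 𝔮 :=
  exists_mem_of_not_isRegularLocalRing_nodeDeformationRing_aux t ht hdim s _ rfl 𝔮 h𝔮

end Summit.ResolutionOfSingularities.ResolutionOfSingularities.Theorems

end
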